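import Mathlib
import Summits.Ventures.HodgeRepro2.T5LevelReduction

/-!
# T6N5Level — Lemma N5.L1 (level and K_∞-type) as carrier-free glue over p4's `T5LevelReduction`

Tier 6 (README §10), sub-step N5 of the M2 discharge (t6-p7).  TIER5 §N5.5(a) (Lemma N5.L1 [A], ll.
1970–1971): «If P := P_{T_A,χ_A} is not identically zero on π₀, then there is an open compact
K₀ ⊂ U(W_A)(𝔸_f) with P ≢ 0 on π₀^{K₀,τ′}.»  Its proof: pick f with P(f) ≠ 0 and let K₀ be its
stabiliser (open compact since f is smooth — so f ∈ π₀^{K₀}); put f′ := the χ_{A,∞}-isotypic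
projection of f under K_{∞,2} × K_{∞,3} (f′ is still K₀-fixed: the archimedean and finite actions
commute) and observe P(f′) = P(f) by the T_A(𝔸)-equivariance of P.  Hence f′ ∈ π₀^{K₀,τ′} and
P(f′) ≠ 0.

Over an abstract ℂ-module this is: `V` (= π₀), a family `fix : κ → Submodule ℂ V` (= the K-fixed
subspaces, κ = the open compact subgroups) whose supremum is ⊤ (smoothness: every vector is fixed by
some open compact), a ℂ-linear projector `e` (= the τ′-isotypic projection) that preserves every
`fix K` and through which the functional `P` factors (`P ∘ e = P`, the equivariance step); then
`P ≠ 0 → ∃ K, ∃ v ∈ fix K ⊓ range e, P v ≠ 0` — i.e. `ToricSide.levelReduction` for the side whose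
`levelPeriodNonzero` is «∃ K, P ≢ 0 on fix K ⊓ range e».  p4's `T5LevelReduction.
exists_mem_ne_zero_of_iSup_eq_top` supplies the first step (a non-zero functional is non-zero on
some member of a family with supremum ⊤).  Nothing automorphic is constructed.

§8(d): uses an L-value-free non-vanishing device: NO.
-/

namespace Summit.Ventures.HodgeRepro2.T6.N5Level

open Summit.Ventures.HodgeRepro2.T5LevelReduction

variable {V : Type*} [AddCommGroup V] [Module ℂ V] {κ : Type*}

/-- N5.L1 over an abstract module: a non-zero functional `P` that factors through a projector `e`
preserving the level subspaces `fix K` (whose supremum is ⊤) is non-zero on some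
`fix K ⊓ LinearMap.range e` (= the K-fixed vectors of type τ′). -/
theorem exists_mem_fix_inf_range_ne_zero (fix : κ → Submodule ℂ V) (htop : ⨆ K, fix K = ⊤)
    (e : V →ₗ[ℂ] V) (hstab : ∀ K, ∀ v ∈ fix K, e v ∈ fix K)
    (P : V →ₗ[ℂ] ℂ) (hPe : ∀ v, P (e v) = P v) (hP : P ≠ 0) :
    ∃ K, ∃ v ∈ fix K ⊓ LinearMap.range e, P v ≠ 0 := by
  obtain ⟨K, v, hv, hPv⟩ := exists_mem_ne_zero_of_iSup_eq_top fix htop P hP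
  refine ⟨K, e v, ⟨hstab K v hv, ⟨v, rfl⟩⟩, ?_⟩
  rw [hPe v]
  exact hPv

/-- The pointwise form: with `e` idempotent (a projector), some vector `v` of level `K` that is its
own τ′-projection (`e v = v`) has `P v ≠ 0` — the «f′ ∈ π₀^{K₀,τ′}, P(f′) ≠ 0» of N5.5(a). -/
theorem exists_level_type_ne_zero (fix : κ → Submodule ℂ V) (htop : ⨆ K, fix K = ⊤)
    (e : V →ₗ[ℂ] V) (he : ∀ v, e (e v) = e v) (hstab : ∀ K, ∀ v ∈ fix K, e v ∈ fix K)
    (P : V →ₗ[ℂ] ℂ) (hPe : ∀ v, P (e v) = P v) (hP : P ≠ 0) :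
    ∃ K, ∃ v, v ∈ fix K ∧ e v = v ∧ P v ≠ 0 := by
  obtain ⟨K, v, hv, hPv⟩ := exists_mem_ne_zero_of_iSup_eq_top fix htop P hP
  refine ⟨K, e v, hstab K v hv, he v, ?_⟩
  rw [hPe v]
  exact hPv

/-- The equivariance step of N5.5(a) in its own right: if `P` is invariant under averaging over a
finite family of operators (`P (g v) = P v` for every operator `g` of the family), then `P` factors
through the average `e := (1/|family|) Σ g` — `P (e v) = P v`. -/
theorem apply_average_eq {ι : Type*} (s : Finset ι) (hs : s.Nonempty) (g : ι → V →ₗ[ℂ] V)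
    (P : V →ₗ[ℂ] ℂ) (hg : ∀ i ∈ s, ∀ v, P (g i v) = P v) (v : V) :
    P (((s.card : ℂ)⁻¹) • ∑ i ∈ s, g i v) = P v := by
  rw [map_smul, map_sum]
  rw [Finset.sum_congr rfl fun i hi => hg i hi v]
  rw [Finset.sum_const, nsmul_eq_mul, smul_eq_mul, ← mul_assoc,
    inv_mul_cancel₀ (by exact_mod_cast hs.card_ne_zero), one_mul]

end Summit.Ventures.HodgeRepro2.T6.N5Level
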